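import Literature.Analysis.FunctionSpaces.BMOCarlesonPotential
import Literature.Analysis.UnboundedOperators.HeatKernelLpSmoothingProofs
import Literature.Analysis.UnboundedOperators.HeatKernelHeatEquation
import Mathlib.Analysis.SpecialFunctions.JapaneseBracket
import Mathlib.Analysis.SpecialFunctions.Integrals.Basic
import HarnessLib

/-!
# `L^d ⊂ BMO⁻¹` (discharge of `Literature.Analysis.FunctionSpaces.memBMOInv_of_memLp_dim`)

Topic `Analysis/FunctionSpaces`; sibling proof file of `BMO.lean`, on top of the Koch–Tataru
cluster (`BMOCarleson*.lean`, which discharges Koch–Tataru's Theorem 1,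
`Literature.Analysis.FunctionSpaces.memBMOInv_iff_carleson_heat_holds`, and in particular proves its converse direction
`Literature.Analysis.FunctionSpaces.memBMOInv_of_eCarlesonNorm_lt_top`) and of the `L^p → L^q` smoothing of the heat semigroup
(`Literature/Analysis/UnboundedOperators/HeatKernelLpSmoothingProofs.lean`). It **proves the named
fact `Literature.Analysis.FunctionSpaces.memBMOInv_of_memLp_dim`** of `BMO.lean`: on a finite-dimensional real inner product space
`E` of dimension `d ≥ 1`, every `u ∈ L^d(E)` is in `BMO⁻¹`, i.e. `u = div Φ` weakly for a vector
field `Φ` with `BMO` components (Koch–Tataru, *Well-posedness for the Navier–Stokes equations*,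
Adv. Math. 157 (2001), §4, "Other function spaces", eq. (23): `Lⁿ(ℝⁿ) ⊂ B^{-1+n/p}_{p,∞} ⊂ BMO⁻¹`,
combined with their Theorem 1, `BMO⁻¹ = ∇ · (BMO)ⁿ`).

## The proof (Koch–Tataru 2001, p. 11–12 of the held copy, with the endpoint exponents)

Koch–Tataru define `‖u‖²_{BMO⁻¹} = sup_{x,R} |B(x,R)|⁻¹ ∫₀^{R²}∫_{B(x,R)} |e^{tΔ}u|² dy dt` (§1, (3);
here `Literature.Analysis.FunctionSpaces.BMOInv.eCarlesonNorm`, normalised by `R^{-d}`) and prove (23) from "standard kernel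
estimates and Young's inequality", `(4πt)^{(1-n/p)/2} ‖e^{tΔ}u‖_{L^p} ≤ ‖u‖_{Lⁿ}`, followed by
Hölder's inequality on the ball `B(x,R)`. We run the printed argument with the two endpoint
exponents `p = ∞` and `p = n = d` of the kernel estimate, which are in the tree:

* `‖e^{tΔ}u‖_{L^∞} ≤ C t^{-1/2} ‖u‖_{L^d}` (`Literature.Analysis.UnboundedOperators.eLpNorm_heatExtension_le_rpow_holds` with
  `p = d`, `q = ∞`; `Literature.Analysis.FunctionSpaces.exists_eLpNorm_top_heatExtension_le_of_dim`) and
  `‖e^{tΔ}u‖_{L^d} ≤ ‖u‖_{L^d}` (`Literature.Analysis.UnboundedOperators.eLpNorm_heatExtension_le_holds`, Young);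
* hence, by Hölder on the ball (`MeasureTheory.eLpNorm_le_eLpNorm_mul_rpow_measure_univ`),
  `∫_{B(x,R)} |e^{tΔ}u|² ≤ ‖e^{tΔ}u‖_∞ ∫_{B(x,R)} |e^{tΔ}u| ≤ C t^{-1/2} |B(x,R)|^{1-1/d} ‖u‖²_{L^d}`
  (`Literature.Analysis.FunctionSpaces.lintegral_ball_enorm_heatExtension_sq_le`);
* `∫₀^{R²} t^{-1/2} dt = 2R` and `|B(x,R)|^{1-1/d} = |B(0,1)|^{1-1/d} R^{d-1}`, so that
  `R^{-d} ∫₀^{R²}∫_{B(x,R)} |e^{tΔ}u|² ≤ 2C |B(0,1)|^{1-1/d} ‖u‖²_{L^d}`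
  (`Literature.Analysis.FunctionSpaces.eCarlesonNorm_le_of_memLp_dim`: the embedding `L^d ⊂ BMO⁻¹` in Koch–Tataru's own norm);
* `L^d` functions are locally integrable and tempered (`(1 + ‖y‖²)^{-(d+1)} u ∈ L¹`,
  `Literature.Analysis.FunctionSpaces.integrable_inv_one_add_norm_sq_pow_mul_of_memLp`), so Koch–Tataru's Theorem 1 in the proved
  form `Literature.Analysis.FunctionSpaces.memBMOInv_of_eCarlesonNorm_lt_top` yields the divergence representation.

The caloric extension of the `UnboundedOperators` trunk (`Literature.Analysis.UnboundedOperators.heatExtension`, a Mathlib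
convolution) and the one of `BMO.lean` (`Literature.Analysis.FunctionSpaces.BMOInv.heatExtension`, the reflected integral) agree
pointwise (`Literature.Analysis.FunctionSpaces.BMOInv.heatExtension_eq_heatExtension`; the kernels agree definitionally, as
announced in the design notes of `BMO.lean`).

Only theorems are declared (no new definitions).

## References

* H. Koch, D. Tataru, *Well-posedness for the Navier–Stokes equations*, Adv. Math. 157 (2001),
  22–35, doi:10.1006/aima.2000.1937: §1 (the `BMO⁻¹` norm (3), Theorem 1) and §4, "Other function
  spaces", eq. (23) (held: `paper:doi-10-1006-aima-2000-1937`, pp. 3, 11–12). [KochTataruAdvMath2001]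
* M.-H. Giga, Y. Giga, J. Saal, *Nonlinear Partial Differential Equations* (2010), §1.1.2–§1.1.3
  (`L^p`–`L^q` estimates for `e^{tΔ}`). [GigaGigaSaal2010]
-/

noncomputable section

open MeasureTheory Metric Filter Topology
open scoped ENNReal NNReal RealInnerProductSpace

namespace Literature.Analysis.FunctionSpaces

variable {E : Type*} [NormedAddCommGroup E] [InnerProductSpace ℝ E] [FiniteDimensional ℝ E]
  [MeasurableSpace E] [BorelSpace E]

/-! ## The two caloric extensions agree -/

namespace BMOInv

omit [FiniteDimensional ℝ E] [MeasurableSpace E] [BorelSpace E] in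
/-- The Gauss–Weierstrass kernel of `BMO.lean` is the one of the `UnboundedOperators` trunk
(same formula; Evans, *PDE*, §2.3.1). [folklore] -/
theorem heatKernel_eq_heatKernel (t : ℝ) (x : E) :
    BMOInv.heatKernel t x = _root_.Literature.Analysis.UnboundedOperators.heatKernel t x := rfl

/-- The caloric extension `e^{tΔ}u` of `BMO.lean`, `∫ K_t(x - y) u(y) dy`, is the convolution
`heatKernel t ⋆ u` of the `UnboundedOperators` trunk (reflection of the integration variable,
`Literature.Analysis.UnboundedOperators.heatExtension_eq_integral_sub`; Evans, *PDE*, §2.3.1 (12)). [folklore] -/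
theorem heatExtension_eq_heatExtension (u : E → ℝ) (t : ℝ) (x : E) :
    BMOInv.heatExtension u t x = _root_.Literature.Analysis.UnboundedOperators.heatExtension u t x := by
  rw [_root_.Literature.Analysis.UnboundedOperators.heatExtension_eq_integral_sub]
  rfl

end BMOInv

/-! ## `L^p` functions are tempered -/

/-- **`L^p` functions are tempered** in Koch–Tataru's sense: for `u ∈ L^p(E)`, `1 ≤ p < ∞`, the
function `(1 + ‖y‖²)^{-(d+1)} u` is integrable, `d = dim E` (domination
`|(1 + ‖y‖²)^{-(d+1)} u| ≤ (1 + ‖y‖²)^{-(d+1)} + |u|^p` by the integrable right-hand side,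
`Mathlib`'s `integrable_rpow_neg_one_add_norm_sq`). [folklore] -/
theorem integrable_inv_one_add_norm_sq_pow_mul_of_memLp {u : E → ℝ} {p : ℝ≥0∞} (hp : 1 ≤ p)
    (hp' : p ≠ ∞) (hu : MemLp u p) :
    Integrable fun y : E => ((1 + ‖y‖ ^ 2) ^ (Module.finrank ℝ E + 1))⁻¹ * u y := by
  set N : ℕ := Module.finrank ℝ E + 1 with hN
  have hp0 : p ≠ 0 := (zero_lt_one.trans_le hp).ne'
  have hp1 : (1 : ℝ) ≤ p.toReal := by
    have h := ENNReal.toReal_mono hp' hp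
    rwa [ENNReal.toReal_one] at h
  -- the weight is integrable
  have hw : Integrable fun y : E => ((1 + ‖y‖ ^ 2) ^ N)⁻¹ := by
    have h := integrable_rpow_neg_one_add_norm_sq (E := E) (μ := volume) (r := 2 * N) (by
      rw [hN]; push_cast; linarith)
    refine h.congr (Eventually.of_forall fun y => ?_)
    have h1 : (0 : ℝ) < 1 + ‖y‖ ^ 2 := by positivity
    simp only
    rw [show -(2 * (N : ℝ)) / 2 = -(N : ℝ) by ring, Real.rpow_neg h1.le, Real.rpow_natCast]
  have hup : Integrable fun y : E => ‖u y‖ ^ p.toReal := hu.integrable_norm_rpow hp0 hp'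
  have hwc : Continuous fun y : E => ((1 + ‖y‖ ^ 2) ^ N)⁻¹ :=
    Continuous.inv₀ (by fun_prop) fun y => by positivity
  refine (hw.add hup).mono' (hwc.aestronglyMeasurable.mul hu.1) (Eventually.of_forall fun y => ?_)
  have hw0 : 0 < ((1 + ‖y‖ ^ 2) ^ N)⁻¹ := by positivity
  have hw1 : ((1 + ‖y‖ ^ 2) ^ N)⁻¹ ≤ 1 := by
    apply inv_le_one_of_one_le₀
    exact one_le_pow₀ (by nlinarith [sq_nonneg ‖y‖])
  have hu1 : ‖u y‖ ≤ 1 + ‖u y‖ ^ p.toReal := by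
    rcases le_or_gt 1 ‖u y‖ with h | h
    · calc ‖u y‖ = ‖u y‖ ^ (1 : ℝ) := (Real.rpow_one _).symm
        _ ≤ ‖u y‖ ^ p.toReal := Real.rpow_le_rpow_of_exponent_le h hp1
        _ ≤ 1 + ‖u y‖ ^ p.toReal := le_add_of_nonneg_left zero_le_one
    · exact h.le.trans (le_add_of_nonneg_right (Real.rpow_nonneg (norm_nonneg _) _))
  rw [norm_mul, Real.norm_of_nonneg hw0.le, Pi.add_apply]
  calc ((1 + ‖y‖ ^ 2) ^ N)⁻¹ * ‖u y‖
      ≤ ((1 + ‖y‖ ^ 2) ^ N)⁻¹ * (1 + ‖u y‖ ^ p.toReal) := by gcongr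
    _ = ((1 + ‖y‖ ^ 2) ^ N)⁻¹ + ((1 + ‖y‖ ^ 2) ^ N)⁻¹ * ‖u y‖ ^ p.toReal := by ring
    _ ≤ ((1 + ‖y‖ ^ 2) ^ N)⁻¹ + 1 * ‖u y‖ ^ p.toReal := by gcongr
    _ = ((1 + ‖y‖ ^ 2) ^ N)⁻¹ + ‖u y‖ ^ p.toReal := by rw [one_mul]

/-! ## Koch–Tataru's Carleson bound for `L^d` data -/

section Carleson

variable [Nontrivial E]

/-- **The `L^d → L^∞` kernel estimate** `‖e^{tΔ}u‖_{L^∞} ≤ C t^{-1/2} ‖u‖_{L^d}`, `d = dim E ≥ 1`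
(Koch–Tataru 2001, proof of (23): "standard kernel estimates and Young's inequality", the case
`p = ∞`; here from the tree's `L^p → L^q` smoothing `Literature.Analysis.UnboundedOperators.eLpNorm_heatExtension_le_rpow_holds`,
Giga–Giga–Saal §1.1.3, with `p = d`, `q = ∞`). [cite: KochTataruAdvMath2001, §4 eq. (23) (proof)] -/
theorem exists_eLpNorm_top_heatExtension_le_of_dim :
    ∃ C : ℝ≥0, ∀ (f : E → ℝ), MemLp f (Module.finrank ℝ E : ℝ≥0∞) → ∀ t : ℝ, 0 < t →
      eLpNorm (UnboundedOperators.heatExtension f t) ∞ volume ≤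
        C * ENNReal.ofReal (t ^ (-(1 / 2 : ℝ))) * eLpNorm f (Module.finrank ℝ E : ℝ≥0∞) volume := by
  have hd0 : 0 < Module.finrank ℝ E := Module.finrank_pos
  have h1d : (1 : ℝ≥0∞) ≤ (Module.finrank ℝ E : ℝ≥0∞) := by exact_mod_cast hd0
  obtain ⟨C, hC⟩ := UnboundedOperators.eLpNorm_heatExtension_le_rpow_holds E ℝ (p := (Module.finrank ℝ E : ℝ≥0∞))
    (q := ∞) h1d le_top
  refine ⟨C, fun f hf t ht => ?_⟩
  have h := hC f hf t ht
  have hexp : -((Module.finrank ℝ E : ℝ) / 2) *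
      ((1 / (Module.finrank ℝ E : ℝ≥0∞)).toReal - (1 / (∞ : ℝ≥0∞)).toReal) = -(1 / 2 : ℝ) := by
    have hd' : (Module.finrank ℝ E : ℝ) ≠ 0 := by exact_mod_cast hd0.ne'
    rw [ENNReal.div_top, ENNReal.toReal_zero, sub_zero, one_div, ENNReal.toReal_inv,
      ENNReal.toReal_natCast]
    field_simp
  rwa [hexp] at h

/-- `∫₀^{R²} t^{-1/2} dt = 2R` as a lower Lebesgue integral (`R > 0`). [folklore] -/
theorem lintegral_Ioo_sq_rpow_neg_half {R : ℝ} (hR : 0 < R) :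
    ∫⁻ t in Set.Ioo 0 (R ^ 2), ENNReal.ofReal (t ^ (-(1 / 2 : ℝ))) = ENNReal.ofReal (2 * R) := by
  have hr : (-1 : ℝ) < -(1 / 2 : ℝ) := by norm_num
  have hR2 : 0 < R ^ 2 := by positivity
  have hii : IntervalIntegrable (fun t : ℝ => t ^ (-(1 / 2 : ℝ))) volume 0 (R ^ 2) :=
    intervalIntegral.intervalIntegrable_rpow' hr
  have hint : IntegrableOn (fun t : ℝ => t ^ (-(1 / 2 : ℝ))) (Set.Ioo 0 (R ^ 2)) :=
    (hii.1).mono_set Set.Ioo_subset_Ioc_self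
  have hnn : 0 ≤ᵐ[volume.restrict (Set.Ioo 0 (R ^ 2))] fun t : ℝ => t ^ (-(1 / 2 : ℝ)) :=
    (ae_restrict_mem measurableSet_Ioo).mono fun t ht => Real.rpow_nonneg ht.1.le _
  rw [← ofReal_integral_eq_lintegral_ofReal hint hnn, ← integral_Ioc_eq_integral_Ioo,
    ← intervalIntegral.integral_of_le hR2.le, integral_rpow (Or.inl hr)]
  congr 1
  rw [Real.zero_rpow (by norm_num), sub_zero, show (-(1 / 2 : ℝ) + 1) = 1 / 2 by norm_num,
    ← Real.sqrt_eq_rpow, Real.sqrt_sq hR.le]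
  ring

/-- **Hölder on the ball** (Koch–Tataru 2001, proof of (23), the display
`|B|⁻¹ ∫_Q |v|² ≤ …`): for `u ∈ L^d`, `t > 0` and a ball `B = B(x,R)`,
`∫_B |e^{tΔ}u|² ≤ ‖e^{tΔ}u‖_∞ ∫_B |e^{tΔ}u| ≤ C t^{-1/2} ‖u‖_{L^d} · |B|^{1-1/d} ‖e^{tΔ}u‖_{L^d}
≤ C t^{-1/2} |B|^{1-1/d} ‖u‖²_{L^d}`, given the `L^d → L^∞` kernel estimate with constant `C`
(hypothesis `hC`, see `exists_eLpNorm_top_heatExtension_le_of_dim`) and the `L^d` contraction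
`Literature.Analysis.UnboundedOperators.eLpNorm_heatExtension_le_holds`. [cite: KochTataruAdvMath2001, §4 eq. (23) (proof)] -/
theorem lintegral_ball_enorm_heatExtension_sq_le {C : ℝ≥0}
    (hC : ∀ (f : E → ℝ), MemLp f (Module.finrank ℝ E : ℝ≥0∞) → ∀ t : ℝ, 0 < t →
      eLpNorm (UnboundedOperators.heatExtension f t) ∞ volume ≤
        C * ENNReal.ofReal (t ^ (-(1 / 2 : ℝ))) * eLpNorm f (Module.finrank ℝ E : ℝ≥0∞) volume)
    {u : E → ℝ} (hu : MemLp u (Module.finrank ℝ E : ℝ≥0∞)) {t : ℝ} (ht : 0 < t) (x : E) (R : ℝ) :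
    ∫⁻ y in ball x R, ‖UnboundedOperators.heatExtension u t y‖ₑ ^ 2 ≤
      C * ENNReal.ofReal (t ^ (-(1 / 2 : ℝ))) * eLpNorm u (Module.finrank ℝ E : ℝ≥0∞) volume ^ 2 *
        volume (ball x R) ^ (1 - (Module.finrank ℝ E : ℝ)⁻¹) := by
  have hd0 : 0 < Module.finrank ℝ E := Module.finrank_pos
  have h1d : (1 : ℝ≥0∞) ≤ (Module.finrank ℝ E : ℝ≥0∞) := by exact_mod_cast hd0
  set g : E → ℝ := UnboundedOperators.heatExtension u t with hg
  have hgm : MemLp g (Module.finrank ℝ E : ℝ≥0∞) volume := UnboundedOperators.memLp_heatExtension_holds hu h1d ht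
  have hg_d : eLpNorm g (Module.finrank ℝ E : ℝ≥0∞) volume ≤
      eLpNorm u (Module.finrank ℝ E : ℝ≥0∞) volume := UnboundedOperators.eLpNorm_heatExtension_le_holds hu h1d ht
  have hg_top : eLpNorm g ∞ volume ≤
      C * ENNReal.ofReal (t ^ (-(1 / 2 : ℝ))) * eLpNorm u (Module.finrank ℝ E : ℝ≥0∞) volume :=
    hC u hu t ht
  have hfin : eLpNorm g ∞ volume ≠ ∞ :=
    ne_top_of_le_ne_top (ENNReal.mul_ne_top (ENNReal.mul_ne_top ENNReal.coe_ne_top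
      ENNReal.ofReal_ne_top) hu.eLpNorm_ne_top) hg_top
  -- `∫_B ‖g‖² ≤ ‖g‖_∞ ∫_B ‖g‖`
  have hae : ∀ᵐ y ∂(volume.restrict (ball x R)), ‖g y‖ₑ ^ 2 ≤ eLpNorm g ∞ volume * ‖g y‖ₑ := by
    refine ae_restrict_of_ae ((enorm_ae_le_eLpNormEssSup g volume).mono fun y hy => ?_)
    rw [sq, eLpNorm_exponent_top]
    gcongr
  have step1 : ∫⁻ y in ball x R, ‖g y‖ₑ ^ 2 ≤ eLpNorm g ∞ volume * ∫⁻ y in ball x R, ‖g y‖ₑ := by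
    calc ∫⁻ y in ball x R, ‖g y‖ₑ ^ 2 ≤ ∫⁻ y in ball x R, eLpNorm g ∞ volume * ‖g y‖ₑ :=
          lintegral_mono_ae hae
      _ = eLpNorm g ∞ volume * ∫⁻ y in ball x R, ‖g y‖ₑ := lintegral_const_mul' _ _ hfin
  -- `∫_B ‖g‖ ≤ ‖g‖_{L^d(B)} |B|^{1-1/d} ≤ ‖u‖_{L^d} |B|^{1-1/d}`
  have step2 : ∫⁻ y in ball x R, ‖g y‖ₑ ≤ eLpNorm u (Module.finrank ℝ E : ℝ≥0∞) volume *
      volume (ball x R) ^ (1 - (Module.finrank ℝ E : ℝ)⁻¹) := by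
    have h := eLpNorm_le_eLpNorm_mul_rpow_measure_univ (μ := volume.restrict (ball x R)) h1d
      hgm.aestronglyMeasurable.restrict
    rw [eLpNorm_one_eq_lintegral_enorm, Measure.restrict_apply_univ, ENNReal.toReal_one,
      ENNReal.toReal_natCast, div_one, one_div] at h
    refine h.trans ?_
    gcongr
    exact (eLpNorm_restrict_le _ _ _ _).trans hg_d
  calc ∫⁻ y in ball x R, ‖g y‖ₑ ^ 2 ≤ eLpNorm g ∞ volume * ∫⁻ y in ball x R, ‖g y‖ₑ := step1
    _ ≤ (C * ENNReal.ofReal (t ^ (-(1 / 2 : ℝ))) * eLpNorm u (Module.finrank ℝ E : ℝ≥0∞) volume) *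
        (eLpNorm u (Module.finrank ℝ E : ℝ≥0∞) volume *
          volume (ball x R) ^ (1 - (Module.finrank ℝ E : ℝ)⁻¹)) := mul_le_mul' hg_top step2
    _ = _ := by ring

/-- **The time integration** (Koch–Tataru 2001, proof of (23)): for `u ∈ L^d` and a ball
`B(x,R)`, `∫₀^{R²}∫_{B(x,R)} |e^{tΔ}u|² dy dt ≤ C ‖u‖²_{L^d} |B(x,R)|^{1-1/d} · 2R`, given the
`L^d → L^∞` kernel estimate with constant `C`. [cite: KochTataruAdvMath2001, §4 eq. (23) (proof)] -/
theorem lintegral_Ioo_lintegral_ball_enorm_heatExtension_sq_le {C : ℝ≥0}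
    (hC : ∀ (f : E → ℝ), MemLp f (Module.finrank ℝ E : ℝ≥0∞) → ∀ t : ℝ, 0 < t →
      eLpNorm (UnboundedOperators.heatExtension f t) ∞ volume ≤
        C * ENNReal.ofReal (t ^ (-(1 / 2 : ℝ))) * eLpNorm f (Module.finrank ℝ E : ℝ≥0∞) volume)
    {u : E → ℝ} (hu : MemLp u (Module.finrank ℝ E : ℝ≥0∞)) (x : E) {R : ℝ} (hR : 0 < R) :
    ∫⁻ t in Set.Ioo 0 (R ^ 2), ∫⁻ y in ball x R, ‖UnboundedOperators.heatExtension u t y‖ₑ ^ 2 ≤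
      C * eLpNorm u (Module.finrank ℝ E : ℝ≥0∞) volume ^ 2 *
        volume (ball x R) ^ (1 - (Module.finrank ℝ E : ℝ)⁻¹) * ENNReal.ofReal (2 * R) := by
  calc ∫⁻ t in Set.Ioo 0 (R ^ 2), ∫⁻ y in ball x R, ‖UnboundedOperators.heatExtension u t y‖ₑ ^ 2
      ≤ ∫⁻ t in Set.Ioo 0 (R ^ 2), (C * eLpNorm u (Module.finrank ℝ E : ℝ≥0∞) volume ^ 2 *
          volume (ball x R) ^ (1 - (Module.finrank ℝ E : ℝ)⁻¹)) * ENNReal.ofReal (t ^ (-(1 / 2 : ℝ))) := by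
        refine setLIntegral_mono' measurableSet_Ioo fun t ht => ?_
        calc ∫⁻ y in ball x R, ‖UnboundedOperators.heatExtension u t y‖ₑ ^ 2 ≤ _ :=
              lintegral_ball_enorm_heatExtension_sq_le hC hu ht.1 x R
          _ = _ := by ring
    _ = (C * eLpNorm u (Module.finrank ℝ E : ℝ≥0∞) volume ^ 2 *
          volume (ball x R) ^ (1 - (Module.finrank ℝ E : ℝ)⁻¹)) * ENNReal.ofReal (2 * R) := by
        have hmeas : Measurable fun t : ℝ => ENNReal.ofReal (t ^ (-(1 / 2 : ℝ))) :=
          (measurable_id.pow_const _).ennreal_ofReal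
        rw [lintegral_const_mul _ hmeas, lintegral_Ioo_sq_rpow_neg_half hR]

omit [Nontrivial E] in
/-- **Scaling of balls**: `|B(x,R)|^{1-1/d} · 2R = 2 |B(0,1)|^{1-1/d} R^d` for `R > 0`, `d = dim E ≥ 1`
(`|B(x,R)| = R^d |B(0,1)|`, `MeasureTheory.Measure.addHaar_ball_of_pos`). [folklore] -/
theorem volume_ball_rpow_mul_ofReal_two_mul (hd0 : 0 < Module.finrank ℝ E) (x : E) {R : ℝ} (hR : 0 < R) :
    volume (ball x R) ^ (1 - (Module.finrank ℝ E : ℝ)⁻¹) * ENNReal.ofReal (2 * R) =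
      2 * volume (ball (0 : E) 1) ^ (1 - (Module.finrank ℝ E : ℝ)⁻¹) *
        ENNReal.ofReal (R ^ Module.finrank ℝ E) := by
  have hd' : (Module.finrank ℝ E : ℝ) ≠ 0 := by exact_mod_cast hd0.ne'
  have he : 0 ≤ 1 - (Module.finrank ℝ E : ℝ)⁻¹ := by
    rw [sub_nonneg]
    exact inv_le_one_of_one_le₀ (by exact_mod_cast hd0)
  have hpow : (R ^ Module.finrank ℝ E : ℝ) ^ (1 - (Module.finrank ℝ E : ℝ)⁻¹) =
      R ^ Module.finrank ℝ E / R := by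
    rw [← Real.rpow_natCast, ← Real.rpow_mul hR.le,
      show (Module.finrank ℝ E : ℝ) * (1 - (Module.finrank ℝ E : ℝ)⁻¹) = Module.finrank ℝ E - 1 by
        field_simp,
      Real.rpow_sub_one hR.ne', Real.rpow_natCast]
  rw [Measure.addHaar_ball_of_pos volume x hR, ENNReal.mul_rpow_of_nonneg _ _ he,
    ENNReal.ofReal_rpow_of_pos (by positivity), hpow]
  calc ENNReal.ofReal (R ^ Module.finrank ℝ E / R) *
        volume (ball (0 : E) 1) ^ (1 - (Module.finrank ℝ E : ℝ)⁻¹) * ENNReal.ofReal (2 * R)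
      = volume (ball (0 : E) 1) ^ (1 - (Module.finrank ℝ E : ℝ)⁻¹) *
          (ENNReal.ofReal (R ^ Module.finrank ℝ E / R) * ENNReal.ofReal (2 * R)) := by ring
    _ = volume (ball (0 : E) 1) ^ (1 - (Module.finrank ℝ E : ℝ)⁻¹) *
          (2 * ENNReal.ofReal (R ^ Module.finrank ℝ E)) := by
        rw [← ENNReal.ofReal_mul (by positivity),
          show R ^ Module.finrank ℝ E / R * (2 * R) = 2 * R ^ Module.finrank ℝ E by field_simp,
          ENNReal.ofReal_mul (by norm_num), ENNReal.ofReal_ofNat]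
    _ = _ := by ring

/-- **`L^d ⊂ BMO⁻¹` in Koch–Tataru's norm** (Koch–Tataru 2001, §4, eq. (23):
`Lⁿ(ℝⁿ) ⊂ B^{-1+n/p}_{p,∞} ⊂ BMO⁻¹`, with `‖·‖_{BMO⁻¹}` the Carleson norm (3) of §1): for
`u ∈ L^d(E)`, `d = dim E ≥ 1`,
`sup_{x, R > 0} R^{-d} ∫₀^{R²}∫_{B(x,R)} |e^{tΔ}u|² dy dt ≤ 2C |B(0,1)|^{1-1/d} ‖u‖²_{L^d}`, where
`C` is the constant of the `L^d → L^∞` kernel estimate (hypothesis `hC`,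
`exists_eLpNorm_top_heatExtension_le_of_dim`). [cite: KochTataruAdvMath2001, §4 eq. (23)] -/
theorem eCarlesonNorm_le_of_memLp_dim {C : ℝ≥0}
    (hC : ∀ (f : E → ℝ), MemLp f (Module.finrank ℝ E : ℝ≥0∞) → ∀ t : ℝ, 0 < t →
      eLpNorm (UnboundedOperators.heatExtension f t) ∞ volume ≤
        C * ENNReal.ofReal (t ^ (-(1 / 2 : ℝ))) * eLpNorm f (Module.finrank ℝ E : ℝ≥0∞) volume)
    {u : E → ℝ} (hu : MemLp u (Module.finrank ℝ E : ℝ≥0∞)) :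
    BMOInv.eCarlesonNorm u ≤ 2 * C * volume (ball (0 : E) 1) ^ (1 - (Module.finrank ℝ E : ℝ)⁻¹) *
      eLpNorm u (Module.finrank ℝ E : ℝ≥0∞) volume ^ 2 := by
  have hd0 : 0 < Module.finrank ℝ E := Module.finrank_pos
  refine iSup_le fun x => iSup₂_le fun R hR => ?_
  have hRd : ENNReal.ofReal (R ^ Module.finrank ℝ E) ≠ 0 :=
    (ENNReal.ofReal_pos.mpr (pow_pos hR _)).ne'
  have hI : ∫⁻ t in Set.Ioo 0 (R ^ 2), ∫⁻ y in ball x R, ‖BMOInv.heatExtension u t y‖ₑ ^ 2 ≤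
      C * eLpNorm u (Module.finrank ℝ E : ℝ≥0∞) volume ^ 2 *
        (2 * volume (ball (0 : E) 1) ^ (1 - (Module.finrank ℝ E : ℝ)⁻¹) *
          ENNReal.ofReal (R ^ Module.finrank ℝ E)) := by
    have h := lintegral_Ioo_lintegral_ball_enorm_heatExtension_sq_le hC hu x hR
    simp_rw [← BMOInv.heatExtension_eq_heatExtension] at h
    rw [mul_assoc (C * _ : ℝ≥0∞), volume_ball_rpow_mul_ofReal_two_mul hd0 x hR] at h
    exact h
  calc (ENNReal.ofReal (R ^ Module.finrank ℝ E))⁻¹ *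
        ∫⁻ t in Set.Ioo 0 (R ^ 2), ∫⁻ y in ball x R, ‖BMOInv.heatExtension u t y‖ₑ ^ 2
      ≤ (ENNReal.ofReal (R ^ Module.finrank ℝ E))⁻¹ *
          (C * eLpNorm u (Module.finrank ℝ E : ℝ≥0∞) volume ^ 2 *
            (2 * volume (ball (0 : E) 1) ^ (1 - (Module.finrank ℝ E : ℝ)⁻¹) *
              ENNReal.ofReal (R ^ Module.finrank ℝ E))) := by gcongr
    _ = (ENNReal.ofReal (R ^ Module.finrank ℝ E))⁻¹ * ENNReal.ofReal (R ^ Module.finrank ℝ E) *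
          (2 * C * volume (ball (0 : E) 1) ^ (1 - (Module.finrank ℝ E : ℝ)⁻¹) *
            eLpNorm u (Module.finrank ℝ E : ℝ≥0∞) volume ^ 2) := by ring
    _ = _ := by rw [ENNReal.inv_mul_cancel hRd ENNReal.ofReal_ne_top, one_mul]

/-- **Finiteness of the Koch–Tataru norm of `L^d` data** (Koch–Tataru 2001, §4, eq. (23),
`Lⁿ ⊂ BMO⁻¹`): `sup_{x,R} R^{-d} ∫₀^{R²}∫_{B(x,R)} |e^{tΔ}u|² < ∞` for `u ∈ L^d(E)`.
[cite: KochTataruAdvMath2001, §4 eq. (23)] -/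
theorem eCarlesonNorm_lt_top_of_memLp_dim {u : E → ℝ} (hu : MemLp u (Module.finrank ℝ E : ℝ≥0∞)) :
    BMOInv.eCarlesonNorm u < ∞ := by
  have hd0 : 0 < Module.finrank ℝ E := Module.finrank_pos
  have he : 0 ≤ 1 - (Module.finrank ℝ E : ℝ)⁻¹ := by
    rw [sub_nonneg]
    exact inv_le_one_of_one_le₀ (by exact_mod_cast hd0)
  obtain ⟨C, hC⟩ := exists_eLpNorm_top_heatExtension_le_of_dim (E := E)
  refine (eCarlesonNorm_le_of_memLp_dim hC hu).trans_lt ?_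
  refine ENNReal.mul_lt_top (ENNReal.mul_lt_top (ENNReal.mul_lt_top (by simp) ENNReal.coe_lt_top)
    (ENNReal.rpow_lt_top_of_nonneg he measure_ball_lt_top.ne)) ?_
  exact ENNReal.pow_lt_top hu.eLpNorm_lt_top

end Carleson

/-! ## The discharge -/

/-- **`L^d(ℝ^d) ⊂ BMO⁻¹`**, the named fact `Literature.Analysis.FunctionSpaces.memBMOInv_of_memLp_dim` of `BMO.lean` discharged
(Koch–Tataru, *Well-posedness for the Navier–Stokes equations*, Adv. Math. 157 (2001), §4,
eq. (23): `Lⁿ(ℝⁿ) ⊂ B^{-1+n/p}_{p,∞} ⊂ BMO⁻¹` for the Carleson norm (3), together with their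
Theorem 1, `u ∈ BMO⁻¹ ⇔ u = Σ ∂ᵢfⁱ`, `fⁱ ∈ BMO`): for `d = dim E ≥ 1` and `u ∈ L^d(E)` there is a
vector field `Φ` with `BMO` components and `u = div Φ` weakly. Proof: `u` is locally integrable
(`MeasureTheory.MemLp.locallyIntegrable`) and tempered
(`integrable_inv_one_add_norm_sq_pow_mul_of_memLp`), its Koch–Tataru norm is finite
(`eCarlesonNorm_lt_top_of_memLp_dim`), and the converse half of Theorem 1 is the tree's
`Literature.Analysis.FunctionSpaces.memBMOInv_of_eCarlesonNorm_lt_top`. [cite: KochTataruAdvMath2001, §4 eq. (23)] -/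
theorem memBMOInv_of_memLp_dim_holds : memBMOInv_of_memLp_dim (E := E) := by
  intro _ u hu
  have hd0 : 0 < Module.finrank ℝ E := Module.finrank_pos
  have h1d : (1 : ℝ≥0∞) ≤ (Module.finrank ℝ E : ℝ≥0∞) := by exact_mod_cast hd0
  exact memBMOInv_of_eCarlesonNorm_lt_top (hu.locallyIntegrable h1d)
    ⟨Module.finrank ℝ E + 1,
      integrable_inv_one_add_norm_sq_pow_mul_of_memLp h1d (ENNReal.natCast_ne_top _) hu⟩
    (eCarlesonNorm_lt_top_of_memLp_dim hu)

end Literature.Analysis.FunctionSpaces
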